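import Mathlib.Topology.Instances.ENNReal.Lemmas
import Mathlib.Analysis.SpecificLimits.Basic

/-!
# Route EIHFluxBalance — `InertialRecession`: growing near-zone radii (diagonal argument)

Helper file for the crux `stmt-FinalStateConjecture-10166`
(`Summit.FinalStateConjecture.FinalStateConjecture.Theses.EIHFluxBalance.InertialRecession`).

`HasExhaustiveCharts` (i) asks for near-zone radii `Rᵢ(τ) → ∞` along which the truncated `C²`
deviation of the hole charts still tends to `0`, while the near-zone analysis
(`tendsto_truncDeviationCk_holeChart`) delivers the statement for every FIXED radius. The passage is
the elementary diagonal argument below: if `f(τ, n) → 0` as `τ → ∞` for every `n : ℕ`, then there is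
`R : ℝ → ℝ` with `R → ∞` and `f(τ, R(τ)) → 0` (`exists_growing_radius'`, registered form unprimed). [folklore]
-/

noncomputable section

open scoped Topology ENNReal
open Filter Set

namespace Summit.FinalStateConjecture.FinalStateConjecture.Theorems

/-- **Diagonal argument.** If `f(·, n) → 0` at `+∞` for every `n : ℕ` (values in `ℝ≥0∞`), then there is
a function `R : ℝ → ℝ` with natural values, `R → ∞`, such that `f(τ, R τ) → 0`. [folklore] -/
theorem exists_growing_radius' {f : ℝ → ℝ → ℝ≥0∞}
    (h : ∀ n : ℕ, Tendsto (fun τ ↦ f τ n) atTop (𝓝 0)) :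
    ∃ R : ℝ → ℝ, (∀ τ, ∃ n : ℕ, R τ = n) ∧ Tendsto R atTop atTop ∧
      Tendsto (fun τ ↦ f τ (R τ)) atTop (𝓝 0) := by
  classical
  -- thresholds `T n` with `f τ n ≤ 1/(n+1)` for `τ ≥ T n`
  have hT : ∀ n : ℕ, ∃ T : ℝ, ∀ τ, T ≤ τ → f τ n ≤ ENNReal.ofReal (1 / (n + 1)) := by
    intro n
    have hε : (0 : ℝ≥0∞) < ENNReal.ofReal (1 / (n + 1)) := ENNReal.ofReal_pos.2 (by positivity)
    obtain ⟨T, hT⟩ := eventually_atTop.1 (ENNReal.tendsto_nhds_zero.1 (h n) _ hε)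
    exact ⟨T, hT⟩
  choose T hT using hT
  -- monotone thresholds `S n ≥ n`
  set S : ℕ → ℝ := fun n ↦ max ((Finset.range (n + 1)).sup' ⟨0, by simp⟩ T) (n : ℝ) with hS
  have hST : ∀ n, T n ≤ S n := fun n ↦
    (Finset.le_sup' T (Finset.mem_range.2 (Nat.lt_succ_self n))).trans (le_max_left _ _)
  have hSn : ∀ n : ℕ, (n : ℝ) ≤ S n := fun n ↦ le_max_right _ _
  -- `R τ` = the largest `n ≤ ⌈τ⌉₊` with `S n ≤ τ`
  set R : ℝ → ℝ := fun τ ↦ (Nat.findGreatest (fun n ↦ S n ≤ τ) ⌈τ⌉₊ : ℝ) with hR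
  have hRge : ∀ (n : ℕ) (τ : ℝ), S n ≤ τ → (n : ℝ) ≤ R τ := by
    intro n τ hτ
    have hn : n ≤ ⌈τ⌉₊ := by
      have : (n : ℝ) ≤ τ := (hSn n).trans hτ
      exact_mod_cast this.trans (Nat.le_ceil τ)
    have h := Nat.le_findGreatest (P := fun n ↦ S n ≤ τ) hn hτ
    show (n : ℝ) ≤ (Nat.findGreatest (fun n ↦ S n ≤ τ) ⌈τ⌉₊ : ℝ)
    exact_mod_cast h
  refine ⟨R, fun τ ↦ ⟨_, rfl⟩, ?_, ?_⟩
  · refine tendsto_atTop.2 fun b ↦ ?_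
    refine eventually_atTop.2 ⟨S ⌈b⌉₊, fun τ hτ ↦ ?_⟩
    exact (Nat.le_ceil b).trans (hRge _ τ hτ)
  · -- `f τ (R τ) ≤ 1/(R τ + 1) → 0`
    have hbound : ∀ τ, S 0 ≤ τ → f τ (R τ) ≤ ENNReal.ofReal (1 / (R τ + 1)) := by
      intro τ hτ
      set n : ℕ := Nat.findGreatest (fun n ↦ S n ≤ τ) ⌈τ⌉₊ with hn
      have hspec : S n ≤ τ := Nat.findGreatest_spec (P := fun n ↦ S n ≤ τ) (Nat.zero_le _) hτ
      have h1 := hT n τ ((hST n).trans hspec)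
      have hRn : R τ = n := rfl
      rw [hRn]
      exact h1
    have hlim : Tendsto (fun τ ↦ ENNReal.ofReal (1 / (R τ + 1))) atTop (𝓝 0) := by
      rw [← ENNReal.ofReal_zero]
      refine ENNReal.tendsto_ofReal ?_
      have hR' : Tendsto (fun τ ↦ R τ + 1) atTop atTop :=
        tendsto_atTop_add_const_right _ _ (tendsto_atTop.2 fun b ↦
          eventually_atTop.2 ⟨S ⌈b⌉₊, fun τ hτ ↦ (Nat.le_ceil b).trans (hRge _ τ hτ)⟩)
      have h := tendsto_inv_atTop_zero.comp hR'
      simp only [one_div]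
      exact h
    refine tendsto_of_tendsto_of_tendsto_of_le_of_le' tendsto_const_nhds hlim
      (Eventually.of_forall fun τ ↦ (zero_le : (0 : ℝ≥0∞) ≤ f τ (R τ))) ?_
    exact eventually_atTop.2 ⟨S 0, hbound⟩

/-- Registered sub-goal form (stub `exists_growing_radius` of the crux item) of
`exists_growing_radius'`. [folklore] -/
theorem exists_growing_radius : open Filter Topology in ∀ {f : ℝ → ℝ → ENNReal}, (∀ n : ℕ, Tendsto (fun τ ↦ f τ n) atTop (𝓝 0)) → ∃ R : ℝ → ℝ, (∀ τ, ∃ n : ℕ, R τ = n) ∧ Tendsto R atTop atTop ∧ Tendsto (fun τ ↦ f τ (R τ)) atTop (𝓝 0) :=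
  fun h ↦ exists_growing_radius' h

end Summit.FinalStateConjecture.FinalStateConjecture.Theorems

end
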